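import Summits.MatrixMultiplication.MatrixMultiplication.Theorems.AsymptoticRankCWSkewPencil

/-!
# The torus pencil through `T_cw,2` and `ε`, II: generic domination and the dichotomy at `3`
(route `MatrixMultiplication/AsymptoticRankCW`; support item `BSkewDominatesCw` =
stmt-MatrixMultiplication-18009, stub `stub_skewDominatesCw` of the line `skew_anchor` of the crux
`BThesis` = stmt-MatrixMultiplication-0588; continuation of `AsymptoticRankCWSkewPencil`)

`T_ρ (a, a+1, a+2) = 1`, `T_ρ (a, a+2, a+1) = ρ` (inline), `T_1 ≅ T_cw,2`, `T_{-1} = ε`, `T_0 ≅ ⟨3⟩`.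
From the finite-or-all theorem `pencil_sublevel_finite_or_all` of part I:

* **Generic domination** `countable_pencil_lt_iSup`: the `ρ` with `R̃(T_ρ)` strictly below the
  supremum over the pencil form a COUNTABLE set (union over `n` of the finite sublevel sets at
  `sup - 1/(n+1)`), i.e. `R̃` is generically constant and maximal along the pencil (lower
  semicontinuity); hence `countable_not_cwTensor_le_pencil`, `countable_not_leviCivita_le_pencil`,
  `anchors_le_pencil_of_not_mem`: off that countable set `R̃(T_cw,2) ≤ R̃(T_ρ)` and `R̃(ε) ≤ R̃(T_ρ)` —
  item 18009 holds with `ε` replaced by all but countably many members of its own pencil, and 18009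
  itself is the statement that the orbifold point `ρ = -1` is not exceptional below `ρ = 1`.
* **Dichotomy at `3`** `pencil_arc_dichotomy`: either only finitely many members of the pencil have
  asymptotic rank `3` (`zero_mem_pencil_sublevel_three`: `0` is always one), or every member does and
  then `BThesis`, `BDet3AsymptoticRank` (stub 1 = crux 0591) and `BSkewDominatesCw` (stub 2) all hold
  (`bTheses_of_forall_pencil_le_three`); `bThesis_bDet3_iff_mem_pencil_sublevel_three`: the two
  cruxes are membership of `1`, `-1` in that sublevel set.

References: M. Christandl, K. Hoeberechts, H. Nieuwboer, P. Vrana, J. Zuiddam, STOC 2025 =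
arXiv:2411.15789, Thm 1.2 and §1.1; A. Conner, F. Gesmundo, J. M. Landsberg, E. Ventura,
comput. complexity 31 (2022) = arXiv:1909.04785, §3.2.
-/

set_option linter.dupNamespace false

noncomputable section

namespace Summit.MatrixMultiplication.MatrixMultiplication.Theorems

open Module Submodule
open Literature.Computability.AlgebraicComplexity
open Summit.MatrixMultiplication.MatrixMultiplication.Theses.AsymptoticRankCW
  (BThesis BDet3AsymptoticRank BSkewDominatesCw)

/-! ## The supremum over the pencil is attained off a countable set -/

section Generic

/-- The values `R̃(T_ρ)` are bounded above (by the format bound `27`). [folklore] -/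
theorem bddAbove_range_asymptoticRank_pencil :
    BddAbove (Set.range fun ρ : ℂ => asymptoticRank (fun a b c : Fin 3 =>
      (if b = a + 1 ∧ c = a + 2 then (1 : ℂ) else 0) +
        ρ * (if b = a + 2 ∧ c = a + 1 then (1 : ℂ) else 0))) :=
  ⟨27, by rintro _ ⟨ρ, rfl⟩; exact asymptoticRank_pencil_le ρ⟩

/-- Every member is below the supremum over the pencil. [folklore] -/
theorem asymptoticRank_pencil_le_iSup (ρ : ℂ) :
    asymptoticRank (fun a b c : Fin 3 => (if b = a + 1 ∧ c = a + 2 then (1 : ℂ) else 0) +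
        ρ * (if b = a + 2 ∧ c = a + 1 then (1 : ℂ) else 0)) ≤
      ⨆ ρ' : ℂ, asymptoticRank (fun a b c : Fin 3 => (if b = a + 1 ∧ c = a + 2 then (1 : ℂ) else 0) +
        ρ' * (if b = a + 2 ∧ c = a + 1 then (1 : ℂ) else 0)) :=
  le_ciSup bddAbove_range_asymptoticRank_pencil ρ

/-- **The exceptional set is countable**: the `ρ` with `R̃(T_ρ)` strictly below the supremum over the
pencil form a countable set — it is the union over `n` of the sublevel sets at `sup - 1/(n+1)`, each
of which is finite by `pencil_sublevel_finite_or_all` (it is not all of `ℂ`, by definition of the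
supremum). So `R̃` is CONSTANT (`= sup`) on the pencil off a countable set: the asymptotic rank is
generically maximal along the pencil (lower semicontinuity, CHNVZ 2025 §1.1).
[cite: ChristandlHoeberechtsNieuwboerVranaZuiddam2025, §1.1 (remark after Theorem 1.2)] -/
theorem countable_pencil_lt_iSup :
    Set.Countable {ρ : ℂ | asymptoticRank (fun a b c : Fin 3 =>
        (if b = a + 1 ∧ c = a + 2 then (1 : ℂ) else 0) +
          ρ * (if b = a + 2 ∧ c = a + 1 then (1 : ℂ) else 0)) <
      ⨆ ρ' : ℂ, asymptoticRank (fun a b c : Fin 3 => (if b = a + 1 ∧ c = a + 2 then (1 : ℂ) else 0) +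
        ρ' * (if b = a + 2 ∧ c = a + 1 then (1 : ℂ) else 0))} := by
  set s : ℝ := ⨆ ρ' : ℂ, asymptoticRank (fun a b c : Fin 3 =>
      (if b = a + 1 ∧ c = a + 2 then (1 : ℂ) else 0) +
        ρ' * (if b = a + 2 ∧ c = a + 1 then (1 : ℂ) else 0)) with hs
  -- each sublevel set strictly below the supremum is finite
  have hfin : ∀ n : ℕ, Set.Finite {ρ : ℂ | asymptoticRank (fun a b c : Fin 3 =>
      (if b = a + 1 ∧ c = a + 2 then (1 : ℂ) else 0) +
        ρ * (if b = a + 2 ∧ c = a + 1 then (1 : ℂ) else 0)) ≤ s - 1 / ((n : ℝ) + 1)} := by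
    intro n
    rcases pencil_sublevel_finite_or_all (s - 1 / ((n : ℝ) + 1)) with h | h
    · exact h
    · exfalso
      have hle : s ≤ s - 1 / ((n : ℝ) + 1) := ciSup_le h
      have hpos : (0 : ℝ) < 1 / ((n : ℝ) + 1) := by positivity
      linarith
  have hcount : Set.Countable (⋃ n : ℕ, {ρ : ℂ | asymptoticRank (fun a b c : Fin 3 =>
      (if b = a + 1 ∧ c = a + 2 then (1 : ℂ) else 0) +
        ρ * (if b = a + 2 ∧ c = a + 1 then (1 : ℂ) else 0)) ≤ s - 1 / ((n : ℝ) + 1)}) :=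
    Set.countable_iUnion fun n => (hfin n).countable
  refine hcount.mono ?_
  intro ρ hρ
  simp only [Set.mem_setOf_eq] at hρ
  simp only [Set.mem_iUnion, Set.mem_setOf_eq]
  -- pick `n` with `1/(n+1) ≤ s - R̃(T_ρ)`
  obtain ⟨n, hn⟩ := exists_nat_one_div_lt (sub_pos.mpr hρ)
  exact ⟨n, by linarith⟩

/-- **Generic domination of `T_cw,2` by the pencil**: the set of `ρ` for which
`R̃(T_cw,2) ≤ R̃(T_ρ)` FAILS is countable (it lies in the exceptional set, since
`R̃(T_cw,2) = R̃(T_1) ≤ sup`). Item `BSkewDominatesCw` (stmt-18009) is the assertion that `ρ = -1`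
is not in this countable set. [folklore] -/
theorem countable_not_cwTensor_le_pencil :
    Set.Countable {ρ : ℂ | ¬ asymptoticRank (cwTensor ℂ 2) ≤ asymptoticRank (fun a b c : Fin 3 =>
      (if b = a + 1 ∧ c = a + 2 then (1 : ℂ) else 0) +
        ρ * (if b = a + 2 ∧ c = a + 1 then (1 : ℂ) else 0))} := by
  refine countable_pencil_lt_iSup.mono ?_
  intro ρ hρ
  simp only [Set.mem_setOf_eq, not_le] at hρ ⊢
  refine hρ.trans_le ?_
  rw [← asymptoticRank_pencil_one]
  exact asymptoticRank_pencil_le_iSup 1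

/-- **Generic domination of `ε` by the pencil**: likewise `R̃(ε) ≤ R̃(T_ρ)` off a countable set of `ρ`
(`ε = T_{-1}`). [folklore] -/
theorem countable_not_leviCivita_le_pencil :
    Set.Countable {ρ : ℂ | ¬ asymptoticRank (fun a b c : Fin 3 =>
        (if b = a + 1 ∧ c = a + 2 then (1 : ℂ) else 0) - (if b = a + 2 ∧ c = a + 1 then 1 else 0)) ≤
      asymptoticRank (fun a b c : Fin 3 =>
        (if b = a + 1 ∧ c = a + 2 then (1 : ℂ) else 0) +
          ρ * (if b = a + 2 ∧ c = a + 1 then (1 : ℂ) else 0))} := by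
  refine countable_pencil_lt_iSup.mono ?_
  intro ρ hρ
  simp only [Set.mem_setOf_eq, not_le] at hρ ⊢
  refine hρ.trans_le ?_
  rw [← pencil_neg_one_eq_leviCivita]
  exact asymptoticRank_pencil_le_iSup (-1)

/-- Complement form: off the countable exceptional set, `T_ρ` dominates BOTH anchors,
`R̃(T_cw,2) ≤ R̃(T_ρ)` and `R̃(ε) ≤ R̃(T_ρ)`. [folklore] -/
theorem anchors_le_pencil_of_not_mem {ρ : ℂ}
    (hρ : ρ ∉ {ρ : ℂ | asymptoticRank (fun a b c : Fin 3 =>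
        (if b = a + 1 ∧ c = a + 2 then (1 : ℂ) else 0) +
          ρ * (if b = a + 2 ∧ c = a + 1 then (1 : ℂ) else 0)) <
      ⨆ ρ' : ℂ, asymptoticRank (fun a b c : Fin 3 => (if b = a + 1 ∧ c = a + 2 then (1 : ℂ) else 0) +
        ρ' * (if b = a + 2 ∧ c = a + 1 then (1 : ℂ) else 0))}) :
    asymptoticRank (cwTensor ℂ 2) ≤ asymptoticRank (fun a b c : Fin 3 =>
        (if b = a + 1 ∧ c = a + 2 then (1 : ℂ) else 0) +
          ρ * (if b = a + 2 ∧ c = a + 1 then (1 : ℂ) else 0)) ∧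
      asymptoticRank (fun a b c : Fin 3 =>
        (if b = a + 1 ∧ c = a + 2 then (1 : ℂ) else 0) - (if b = a + 2 ∧ c = a + 1 then 1 else 0)) ≤
      asymptoticRank (fun a b c : Fin 3 =>
        (if b = a + 1 ∧ c = a + 2 then (1 : ℂ) else 0) +
          ρ * (if b = a + 2 ∧ c = a + 1 then (1 : ℂ) else 0)) := by
  simp only [Set.mem_setOf_eq, not_lt] at hρ
  constructor
  · rw [← asymptoticRank_pencil_one]
    exact (asymptoticRank_pencil_le_iSup 1).trans hρ
  · rw [← pencil_neg_one_eq_leviCivita]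
    exact (asymptoticRank_pencil_le_iSup (-1)).trans hρ

end Generic

/-! ## The dichotomy at `r = 3` -/

section Dichotomy

/-- `0` always lies in the sublevel set at `3` (`R̃(T_0) = 3`). [folklore] -/
theorem zero_mem_pencil_sublevel_three :
    (0 : ℂ) ∈ {ρ : ℂ | asymptoticRank (fun a b c : Fin 3 =>
      (if b = a + 1 ∧ c = a + 2 then (1 : ℂ) else 0) +
        ρ * (if b = a + 2 ∧ c = a + 1 then (1 : ℂ) else 0)) ≤ 3} := by
  simp only [Set.mem_setOf_eq]
  exact asymptoticRank_pencil_zero.le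

/-- **If the whole pencil has asymptotic rank `3`, all three cruxes of the line hold**: `BThesis`
(`ρ = 1`), `BDet3AsymptoticRank` (`ρ = -1`: `R̃(ε ⊠ ε) = R̃(ε)² = 9`) and `BSkewDominatesCw`.
[folklore] -/
theorem bTheses_of_forall_pencil_le_three
    (h : ∀ ρ : ℂ, asymptoticRank (fun a b c : Fin 3 =>
      (if b = a + 1 ∧ c = a + 2 then (1 : ℂ) else 0) +
        ρ * (if b = a + 2 ∧ c = a + 1 then (1 : ℂ) else 0)) ≤ 3) :
    BThesis ∧ BDet3AsymptoticRank ∧ BSkewDominatesCw := by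
  have h1 : asymptoticRank (cwTensor ℂ 2) ≤ 3 := by
    rw [← asymptoticRank_pencil_one]; exact h 1
  have hX : BThesis := bThesis_iff_asymptoticRank_cwTensor_le_three.mpr h1
  have hε : asymptoticRank (fun a b c : Fin 3 =>
      (if b = a + 1 ∧ c = a + 2 then (1 : ℂ) else 0) - (if b = a + 2 ∧ c = a + 1 then 1 else 0)) ≤ 3 := by
    rw [← pencil_neg_one_eq_leviCivita]; exact h (-1)
  have hdet : BDet3AsymptoticRank := by
    unfold Summit.MatrixMultiplication.MatrixMultiplication.Theses.AsymptoticRankCW.BDet3AsymptoticRank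
    rw [asymptoticRank_leviCivita_sq_eq_sq]
    refine le_antisymm ?_ ?_
    · nlinarith [hε, three_le_asymptoticRank_leviCivita]
    · nlinarith [hε, three_le_asymptoticRank_leviCivita]
  exact ⟨hX, hdet, bSkewDominatesCw_of_bThesis hX⟩

/-- **Dichotomy at `3`**: EITHER only finitely many members `T_ρ` of the pencil have asymptotic rank
`3` (`0` is always one of them), OR every member does — and then `BThesis`, the skew crux
`BDet3AsymptoticRank` (stub 1 of the line) and `BSkewDominatesCw` (stub 2) all hold, hence `ω = 2`.
[cite: ChristandlHoeberechtsNieuwboerVranaZuiddam2025, Theorem 1.2] -/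
theorem pencil_arc_dichotomy :
    Set.Finite {ρ : ℂ | asymptoticRank (fun a b c : Fin 3 =>
        (if b = a + 1 ∧ c = a + 2 then (1 : ℂ) else 0) +
          ρ * (if b = a + 2 ∧ c = a + 1 then (1 : ℂ) else 0)) ≤ 3} ∨
      (BThesis ∧ BDet3AsymptoticRank ∧ BSkewDominatesCw) := by
  rcases pencil_sublevel_finite_or_all 3 with h | h
  · exact Or.inl h
  · exact Or.inr (bTheses_of_forall_pencil_le_three h)

/-- The two cruxes as membership of the orbifold points in the sublevel set at `3`:
`BThesis ↔ 1 ∈ {R̃(T_ρ) ≤ 3}` and `BDet3AsymptoticRank ↔ -1 ∈ {R̃(T_ρ) ≤ 3}`. [folklore] -/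
theorem bThesis_bDet3_iff_mem_pencil_sublevel_three :
    (BThesis ↔ (1 : ℂ) ∈ {ρ : ℂ | asymptoticRank (fun a b c : Fin 3 =>
      (if b = a + 1 ∧ c = a + 2 then (1 : ℂ) else 0) +
        ρ * (if b = a + 2 ∧ c = a + 1 then (1 : ℂ) else 0)) ≤ 3}) ∧
    (BDet3AsymptoticRank ↔ (-1 : ℂ) ∈ {ρ : ℂ | asymptoticRank (fun a b c : Fin 3 =>
      (if b = a + 1 ∧ c = a + 2 then (1 : ℂ) else 0) +
        ρ * (if b = a + 2 ∧ c = a + 1 then (1 : ℂ) else 0)) ≤ 3}) := by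
  constructor
  · simp only [Set.mem_setOf_eq]
    rw [asymptoticRank_pencil_one]
    exact bThesis_iff_asymptoticRank_cwTensor_le_three
  · simp only [Set.mem_setOf_eq]
    rw [pencil_neg_one_eq_leviCivita]
    constructor
    · intro h; exact (asymptoticRank_leviCivita_eq_three_of_det3 h).le
    · intro h
      unfold Summit.MatrixMultiplication.MatrixMultiplication.Theses.AsymptoticRankCW.BDet3AsymptoticRank
      rw [asymptoticRank_leviCivita_sq_eq_sq]
      refine le_antisymm ?_ ?_
      · nlinarith [h, three_le_asymptoticRank_leviCivita]
      · nlinarith [h, three_le_asymptoticRank_leviCivita]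

end Dichotomy

end Summit.MatrixMultiplication.MatrixMultiplication.Theorems

end
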